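import Literature.AlgebraicGeometry.AbelianSchemes.AbelianSchemeQuotientHatIsDualIsogeny
import Literature.AlgebraicGeometry.AbelianSchemes.AbelianSchemeQuotientHomDescent
import HarnessLib

/-!
# `ψ ≫ λ_B ≫ ψ^∨ = λ ≫ [n]` for the Hecke/isogeny quotient `ψ : A → A/K` — the polarisation pull-back identity (H2c (b))
# ([MumfordAV1970] §23 p. 231, §15 Thm. 1; [MilneAV2008] I §8–§9)

Topic `AlgebraicGeometry/AbelianSchemes`; namespace `Literature.AlgebraicGeometry.AbelianSchemes.AbelianSchemeOver`.
KERNEL ONLY: theorems; no definition, no named fact, no instance, no `sorry`.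

Cell hodgecm-mathlib, Hecke-link line, socket (B) / H2c (b) ASSEMBLY (B-p20 (g9) 22:01:50Z «H2c (b) identity starts here»): with
`ψ := quotientMk : A → A/K`, `λ_B := polarizationDesc` (★ H2c-core p746532: `ψ ≫ λ_B = λ ≫ ψ̂`), `ψ̂ = π^∨` (★ p747383,
`π := mulNDesc`, `ψ ≫ π = [n]` ★ D0), the composition law of ★ `dualIsogeny` and `[n]^∨ = [n]` (B-p05 (g15) (∨-1)/(∨-2), taken here
as the two hypotheses `hcomp`, `hmulN` in their announced shapes until they are ★), the pull-back of the descended polarisation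
along `ψ` is `n` times the original one: `ψ ≫ λ_B ≫ ψ^∨ = λ ≫ [n]_{Â}`.

* `DualPair.dualIsogeny_congr` — `dualIsogeny` depends only on the morphism (instance-irrelevant rewriting helper).
* `quotientMk_comp_polarizationDesc_comp_dualIsogeny` — the identity.

## References
* [MumfordAV1970] §23 (p. 231), §15 Thm. 1 (p. 143), §7 Thm. 4 (p. 72).  * [MilneAV2008] I §8 pp. 36–37, §9 Thm. 9.1 (p. 42).
HC_CM is proved only modulo the 7 printed citations until rung 0 closes; this file discharges none of them.
-/

set_option autoImplicit false

noncomputable section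

universe u

open CategoryTheory CategoryTheory.Limits AlgebraicGeometry MonoidalCategory CartesianMonoidalCategory
open scoped MonObj

namespace Literature.AlgebraicGeometry.AbelianSchemes

namespace AbelianSchemeOver

/-- `dualIsogeny` depends only on the morphism `ψ` (the `IsMonHom` instance is a proposition).
[cite: MilneAV2008, I §8 pp. 36–37] -/
theorem DualPair.dualIsogeny_congr {S : Scheme.{u}} {A' B : AbelianSchemeOver S} {ψ ψ' : A'.X ⟶ B.X} [IsMonHom ψ]
    [IsMonHom ψ'] (h : ψ = ψ') (D' : A'.DualPair) (DB : B.DualPair) :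
    DualPair.dualIsogeny ψ D' DB = DualPair.dualIsogeny ψ' D' DB := by
  subst h
  rfl

variable {S : Scheme.{u}} (A : AbelianSchemeOver S)
  {Y : Scheme.{u}} (u : S ⟶ Y) (K : Subgroup A.Sections) [IsCommMonObj A.X] {n : ℕ}
  (hK : ∀ σ : K, (σ : A.Sections) ^ n = 1)
  [Finite K] [Y.IsSeparated] [IsSeparated (A.X.hom ≫ u)] [S.IsSeparated]
  (hcov : ∀ x : A.left, ∃ O : (A.translationActionOver u K).StableAffineOpens, x ∈ O.1)
  [LocallyOfFiniteType (A.X.hom ≫ u)] [IsLocallyNoetherian Y]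
  (hG : ∃ _ : GrpObj (A.quotientOver u K), IsMonHom (A.quotientMk u K hcov))
  (hsm : Smooth (A.quotientOver u K).hom) (hgc : GeometricallyConnected (A.quotientOver u K).hom)
  (D : A.DualPair) [IsAffine Y]
  (hfree : ∀ (Ω : Type u) [Field Ω] [IsAlgClosed Ω] (x : Spec (.of Ω) ⟶ A.left) (σ : K), σ ≠ 1 →
    x ≫ (A.translation (σ : A.Sections)).left ≠ x)
  (K' : Subgroup D.hat.Sections) [Finite K'] [IsSeparated (D.hat.X.hom ≫ u)]
  (hcov' : ∀ x : D.hat.left, ∃ O : (D.hat.translationActionOver u K').StableAffineOpens, x ∈ O.1)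
  [LocallyOfFiniteType (D.hat.X.hom ≫ u)]
  (hG' : ∃ _ : GrpObj (D.hat.quotientOver u K'), IsMonHom (D.hat.quotientMk u K' hcov'))
  (hsm' : Smooth (D.hat.quotientOver u K').hom) (hgc' : GeometricallyConnected (D.hat.quotientOver u K').hom)
  (hfree' : ∀ (Ω : Type u) [Field Ω] [IsAlgClosed Ω] (x : Spec (.of Ω) ⟶ D.hat.left) (σ : K'), σ ≠ 1 →
    x ≫ (D.hat.translation (σ : D.hat.Sections)).left ≠ x)
  (Φ : (prodTranslationActionOver (A.quotientBy u K hcov hG hsm hgc) D.hat u K' hcov').EquivariantStructure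
    (A.poincarePullback u K hK hcov hG hsm hgc D hfree))

/-- **`ψ ≫ λ_B ≫ ψ^∨ = λ ≫ [n]_{Â}`** (module docstring): for the quotient `ψ : A → A/K` (`K ⊆ A[n]`), the descended
polarisation `λ_B : A/K → Â/K′` of a `K`-compatible `λ : A → Â` and the dual homomorphism `ψ^∨ : (A/K)^ → Â`.  Inputs: ★
`quotientMk_comp_polarizationDesc` (`ψ ≫ λ_B = λ ≫ ψ̂`), ★ `quotientMk_left_eq_dualIsogeny_mulNDesc` (`ψ̂ = π^∨`), ★
`quotientMk_comp_mulNDesc` (`ψ ≫ π = [n]`), and the two functoriality clauses `hcomp` (`(ψ ≫ π)^∨ = π^∨ ≫ ψ^∨`) and `hmulN`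
(`[n]^∨ = [n]`). [cite: MumfordAV1970, §23 (p. 231)] [cite: MilneAV2008, I §9 Thm. 9.1 (p. 42)] -/
theorem quotientMk_comp_polarizationDesc_comp_dualIsogeny (h4)
    (lam : A.X ⟶ D.hat.X)
    (hlam : ∀ σ : K, A.translation (σ : A.Sections) ≫ lam ≫ D.hat.quotientMk u K' hcov' = lam ≫ D.hat.quotientMk u K' hcov')
    (hcomp :
      letI : GrpObj (A.quotientOver u K) := (A.quotientBy u K hcov hG hsm hgc).grpObj
      haveI := A.isMonHom_quotientMk u K hcov hG hsm hgc
      haveI := A.isMonHom_mulNDesc u K hK hcov hG hsm hgc hfree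
      @DualPair.dualIsogeny S A A (A.quotientMk u K hcov ≫ A.mulNDesc u K hK hcov) inferInstance D D =
        @DualPair.dualIsogeny S (A.quotientBy u K hcov hG hsm hgc) A (A.mulNDesc u K hK hcov)
            (A.isMonHom_mulNDesc u K hK hcov hG hsm hgc hfree)
            (A.dualPairOfQuotientRigidified u K hK hcov hG hsm hgc D hfree K' hcov' hG' hsm' hgc' hfree' Φ h4) D ≫
          @DualPair.dualIsogeny S A (A.quotientBy u K hcov hG hsm hgc) (A.quotientMk u K hcov)
            (A.isMonHom_quotientMk u K hcov hG hsm hgc) D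
            (A.dualPairOfQuotientRigidified u K hK hcov hG hsm hgc D hfree K' hcov' hG' hsm' hgc' hfree' Φ h4))
    (hmulN :
      haveI := A.isMonHom_mulN n
      DualPair.dualIsogeny (A.mulN n) D D = (D.hat.mulN n).left) :
    letI : GrpObj (A.quotientOver u K) := (A.quotientBy u K hcov hG hsm hgc).grpObj
    haveI := A.isMonHom_quotientMk u K hcov hG hsm hgc
    (A.quotientMk u K hcov).left ≫ (A.polarizationDesc u K hcov D.hat K' hcov' lam hlam).left ≫
        @DualPair.dualIsogeny S A (A.quotientBy u K hcov hG hsm hgc) (A.quotientMk u K hcov)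
          (A.isMonHom_quotientMk u K hcov hG hsm hgc) D
          (A.dualPairOfQuotientRigidified u K hK hcov hG hsm hgc D hfree K' hcov' hG' hsm' hgc' hfree' Φ h4) =
      lam.left ≫ (D.hat.mulN n).left := by
  letI : GrpObj (A.quotientOver u K) := (A.quotientBy u K hcov hG hsm hgc).grpObj
  haveI := A.isMonHom_quotientMk u K hcov hG hsm hgc
  haveI := A.isMonHom_mulNDesc u K hK hcov hG hsm hgc hfree
  haveI := A.isMonHom_mulN n
  -- `ψ ≫ λ_B = λ ≫ ψ̂`
  have h1 : (A.quotientMk u K hcov).left ≫ (A.polarizationDesc u K hcov D.hat K' hcov' lam hlam).left =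
      lam.left ≫ (D.hat.quotientMk u K' hcov').left := by
    rw [← Over.comp_left, A.quotientMk_comp_polarizationDesc u K hcov D.hat K' hcov' lam hlam, Over.comp_left]
  rw [← Category.assoc, h1, Category.assoc]
  -- `ψ̂ = π^∨`, then `π^∨ ≫ ψ^∨ = (ψ ≫ π)^∨ = [n]^∨ = [n]`
  rw [A.quotientMk_left_eq_dualIsogeny_mulNDesc u K hK hcov hG hsm hgc D hfree K' hcov' hG' hsm' hgc' hfree' Φ h4]
  exact congrArg (fun t => lam.left ≫ t)
    (hcomp.symm.trans ((DualPair.dualIsogeny_congr (A.quotientMk_comp_mulNDesc u K hK hcov) D D).trans hmulN))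

end AbelianSchemeOver

end Literature.AlgebraicGeometry.AbelianSchemes

end
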